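import Literature.NumberTheory.GaloisRepresentations.WeilDeligneRep
import HarnessLib

/-!
# Generic Weil–Deligne representations (Allen 2016, Definition 1.1.2)

Let `F` be a non-archimedean local field with Weil group `W_F`, residue cardinality `q` and
norm `‖w‖ = q ^ deg w` (sign convention of `Literature.NumberTheory.GaloisRepresentations.WeilGroup`:
an *arithmetic* Frobenius has `deg = +1`; under the Artin map `‖w‖ = |Art⁻¹ w|_F`, which is
Allen's `|w|`), and let `r = (ρ, N)` be a Weil–Deligne representation of `W_F` on a `C`-vector
space `V` (`Literature.NumberTheory.GaloisRepresentations.WeilDeligneRep`; relation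
`ρ(w) N ρ(w)⁻¹ = ‖w‖ N`, the convention of Allen, §1.1.1, and of Tate, Corvallis (4.1.2)).
The **twist** `r(1)` is `(ρ(1), N)` with `ρ(1)(w) = ‖w‖ ρ(w)` (Allen, §1.1.1), and

> **Definition** (Allen, *Deformations of polarized automorphic Galois representations and
> adjoint Selmer groups*, Duke Math. J. **165** (2016), §1.1, Definition 1.1.2).  `r` is
> *generic* if there is no non-trivial morphism of Weil–Deligne representations `r → r(1)`.

Unfolded, a morphism `r → r(1)` is a `C`-linear `f : V → V` with
`f ∘ ρ(w) = ‖w‖ • ρ(w) ∘ f` for all `w ∈ W_F` and `f ∘ N = N ∘ f`; `r` is generic iff every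
such `f` is `0`.  This is hypothesis (e) "`WD(ρ|_{G_{L_v}})` is generic" of A'Campo,
*Rigidity of automorphic Galois representations over CM fields*, IMRN 2024:6, Thm 1.0.1, and by
Allen's Lemma 1.1.3 (= [BLGGT], Lemma 1.3.2(1)) `rec(π)` is generic iff the irreducible
admissible `π` of `GL_d(F)` is generic (Zelevinsky: no two segments linked).

## Contents

* `WeilDeligneRep.twistedHom r r'` — the `C`-subspace `Hom_WD(r, r'(1)) ≤ (V →ₗ[C] V')` of
  linear maps with `f ∘ ρ(w) = ‖w‖ • ρ'(w) ∘ f` and `f ∘ N = N' ∘ f`;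
  `comp_mem_twistedHom` (two-sided functoriality under `WeilDeligneRep.Hom`).
* `WeilDeligneRep.IsGeneric r` — **the definition**, stated literally as above (no auxiliary
  structure, so that `r.IsGeneric` unfolds by `Iff.rfl`, `isGeneric_iff`, to the clause used in
  route statements); `isGeneric_iff_twistedHom_eq_bot`.
* API: `IsGeneric.of_retract` (a direct summand — more generally a retract — of a generic
  representation is generic), `IsGeneric.of_equiv` / `Equiv.isGeneric_iff` (isomorphism
  invariance), `isGeneric_of_subsingleton`, and the first sanity value
  `isGeneric_trivial` (the trivial representation `(1, 0)` on any `V` is generic as soon as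
  `W_F` has an element of non-zero degree, e.g. a Frobenius), resting on
  `residueFieldCard_zpow_ne_one : d ≠ 0 → (q : C) ^ d ≠ 1`.

## Design choices

* The twist `r(1)` is *not* materialised as a `WeilDeligneRep` here: that would need `‖·‖` to
  be a character of `W_F`, i.e. the `LocalGaloisGroup` facts `IsFrobPow.mul/unique` as
  hypotheses (cf. `WeilDeligneRep.unramifiedTwist`, `wdTwist` under `Automorphic/`).  The
  defining clause only uses the scalar `(q : C) ^ deg w`, exactly as the structure field
  `WeilDeligneRep.conj_N` does, so `IsGeneric` carries no such hypotheses.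
* Direction of the twist.  `N` itself satisfies `N ∘ ρ(w) = ‖w‖⁻¹ • ρ(w) ∘ N`, i.e. `N` is a
  morphism `r → r(-1)`; asking for `Hom_WD(r, r(-1)) = 0` would force `N = 0`.  Allen's
  `r → r(1)` is the opposite twist: for the Steinberg-type `Sp₂ = (1 ⊕ ‖·‖, N e₀ = e₁)` one
  finds `Hom_WD(Sp₂, Sp₂(1)) = 0` (generic) while `(1 ⊕ ‖·‖, N = 0)` is not generic (the map
  `e₁ ↦ e₀` is a non-zero morphism to the twist) — the expected sanity values
  (reducibility of `1 × ‖·‖^{±1}`); both are checked in the session scratch file, the second is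
  not shipped because it needs `‖·‖` multiplicative.
* Finite-dimensionality of `V` is not assumed (as in `WeilDeligneRep`).

## What is deliberately NOT here

Invariance under Frobenius-semisimplification (`IsFrobSemisimplificationOf`; the direction
"`r^{F-ss}` generic ⇒ `r` generic" follows from
`WeilDeligneRep.FrobSemisimple.mul_eq_smul_mul_of_jordanChevalley` and is left to the sibling
proofs file to keep this file's imports minimal), the orbit description of genericity for
Frobenius-semisimple `r` over an algebraically closed field (Allen §1.1; Bernstein–Zelevinsky),
and `rec(π)` generic `↔` `π` generic (Allen, Lemma 1.1.3), which needs the local Langlands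
correspondence.
-/

noncomputable section

namespace Literature.NumberTheory.GaloisRepresentations

variable {F : Type*} [Field F] [ValuativeRel F] [TopologicalSpace F] [IsNonarchimedeanLocalField F]

open GaloisRepresentations.IsNonarchimedeanLocalField WeilGroup

namespace WeilDeligneRep

variable {C : Type*} [Field C] [CharZero C] {V : Type*} [AddCommGroup V] [Module C V]
  {V' : Type*} [AddCommGroup V'] [Module C V'] {V₂ : Type*} [AddCommGroup V₂] [Module C V₂]
  {V₃ : Type*} [AddCommGroup V₃] [Module C V₃]

/-! ### Morphisms to the twist `r'(1)` -/

/-- The `C`-subspace `Hom_WD(r, r'(1))` of **morphisms of Weil–Deligne representations from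
`r = (ρ, N)` to the twist `r'(1) = (‖·‖ ρ', N')`**: linear maps `f : V → V'` with
`f ∘ ρ(w) = ‖w‖ • ρ'(w) ∘ f = q ^ deg w • ρ'(w) ∘ f` for all `w ∈ W_F` and `f ∘ N = N' ∘ f`.
Ref: Allen, Duke Math. J. 165 (2016), §1.1.1 (`(r,N)(1) = (r(1),N)`, `r(1)(w) = |w| r(w)`).
[cite: Allen2016, §1.1.1] -/
def twistedHom (r : WeilDeligneRep F C V) (r' : WeilDeligneRep F C V') :
    Submodule C (V →ₗ[C] V') where
  carrier := {f | (∀ w : WeilGroup F,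
      f ∘ₗ r.ρ w = ((residueFieldCard F : C) ^ (deg w)) • (r'.ρ w ∘ₗ f)) ∧ f ∘ₗ r.N = r'.N ∘ₗ f}
  zero_mem' := ⟨fun w => by simp, by simp⟩
  add_mem' := by
    rintro f g ⟨hf, hfN⟩ ⟨hg, hgN⟩
    refine ⟨fun w => ?_, ?_⟩
    · rw [LinearMap.add_comp, LinearMap.comp_add, hf w, hg w, smul_add]
    · rw [LinearMap.add_comp, LinearMap.comp_add, hfN, hgN]
  smul_mem' := by
    rintro a f ⟨hf, hfN⟩
    refine ⟨fun w => ?_, ?_⟩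
    · rw [LinearMap.smul_comp, LinearMap.comp_smul, hf w, smul_comm]
    · rw [LinearMap.smul_comp, LinearMap.comp_smul, hfN]

/-- Membership in `Hom_WD(r, r'(1))`, unfolded.  Ref: Allen, Duke Math. J. 165 (2016), §1.1.1.
[cite: Allen2016, §1.1.1] -/
theorem mem_twistedHom_iff (r : WeilDeligneRep F C V) (r' : WeilDeligneRep F C V')
    (f : V →ₗ[C] V') :
    f ∈ r.twistedHom r' ↔
      (∀ w : WeilGroup F, f ∘ₗ r.ρ w = ((residueFieldCard F : C) ^ (deg w)) • (r'.ρ w ∘ₗ f)) ∧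
        f ∘ₗ r.N = r'.N ∘ₗ f :=
  Iff.rfl

/-- **Functoriality of `Hom_WD(r, r'(1))`**: for morphisms of Weil–Deligne representations
`g : r₂ → r` and `h : r' → r₃` (a morphism `r' → r₃` is also one `r'(1) → r₃(1)`), the composite
`h ∘ f ∘ g` of a morphism `f : r → r'(1)` is a morphism `r₂ → r₃(1)`.
Ref: Allen, Duke Math. J. 165 (2016), §1.1.1. [folklore] -/
theorem comp_mem_twistedHom {r : WeilDeligneRep F C V} {r' : WeilDeligneRep F C V'}
    {r₂ : WeilDeligneRep F C V₂} {r₃ : WeilDeligneRep F C V₃} {f : V →ₗ[C] V'}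
    (hf : f ∈ r.twistedHom r') (g : Hom r₂ r) (h : Hom r' r₃) :
    h.toLinearMap ∘ₗ f ∘ₗ g.toLinearMap ∈ r₂.twistedHom r₃ := by
  obtain ⟨hfρ, hfN⟩ := hf
  refine ⟨fun w => ?_, ?_⟩
  · have e1 : f ∘ₗ r.ρ w ∘ₗ g.toLinearMap =
        ((residueFieldCard F : C) ^ (deg w)) • (r'.ρ w ∘ₗ f ∘ₗ g.toLinearMap) := by
      rw [← LinearMap.comp_assoc, hfρ w, LinearMap.smul_comp, LinearMap.comp_assoc]
    have e2 : h.toLinearMap ∘ₗ r'.ρ w ∘ₗ (f ∘ₗ g.toLinearMap) =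
        r₃.ρ w ∘ₗ h.toLinearMap ∘ₗ (f ∘ₗ g.toLinearMap) := by
      rw [← LinearMap.comp_assoc, h.isIntertwining' w, LinearMap.comp_assoc]
    simp only [LinearMap.comp_assoc]
    rw [g.isIntertwining' w, e1, LinearMap.comp_smul, e2]
  · have e1 : f ∘ₗ r.N ∘ₗ g.toLinearMap = r'.N ∘ₗ f ∘ₗ g.toLinearMap := by
      rw [← LinearMap.comp_assoc, hfN, LinearMap.comp_assoc]
    have e2 : h.toLinearMap ∘ₗ r'.N ∘ₗ (f ∘ₗ g.toLinearMap) =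
        r₃.N ∘ₗ h.toLinearMap ∘ₗ (f ∘ₗ g.toLinearMap) := by
      rw [← LinearMap.comp_assoc, h.comm_N, LinearMap.comp_assoc]
    simp only [LinearMap.comp_assoc]
    rw [g.comm_N, e1, e2]

/-! ### Generic representations -/

/-- A Weil–Deligne representation `r = (ρ, N)` of `W_F` on `V` is **generic** if there is no
non-trivial morphism of Weil–Deligne representations `r → r(1)` to its twist
`r(1) = (‖·‖ ρ, N)`, i.e. every `C`-linear `f : V → V` with `f ∘ ρ(w) = q ^ deg w • ρ(w) ∘ f`
for all `w ∈ W_F` (`q ^ deg w = ‖w‖`) and `f ∘ N = N ∘ f` is zero.  Equivalently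
`Hom_WD(r, r(1)) = r.twistedHom r = ⊥` (`isGeneric_iff_twistedHom_eq_bot`).  For
`r = rec(π)` this is genericity of `π` (Allen, Lemma 1.1.3); it is the smoothness condition for
points of local deformation rings (Allen, §1.2–1.3) and hypothesis (e) of A'Campo, IMRN 2024,
Thm 1.0.1.
Ref: Allen, *Deformations of polarized automorphic Galois representations and adjoint Selmer
groups*, Duke Math. J. 165 (2016), §1.1, Definition 1.1.2. [cite: Allen2016, Def. 1.1.2] -/
def IsGeneric (r : WeilDeligneRep F C V) : Prop :=
  ∀ f : V →ₗ[C] V,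
    (∀ w : WeilGroup F, f ∘ₗ r.ρ w = ((residueFieldCard F : C) ^ (deg w)) • (r.ρ w ∘ₗ f)) →
      f ∘ₗ r.N = r.N ∘ₗ f → f = 0

/-- Unfolding lemma for `IsGeneric` (by `Iff.rfl`): the clause as it is written inline in route
statements.  Ref: Allen, Duke Math. J. 165 (2016), Def. 1.1.2. [cite: Allen2016, Def. 1.1.2] -/
theorem isGeneric_iff (r : WeilDeligneRep F C V) :
    r.IsGeneric ↔ ∀ f : V →ₗ[C] V,
      (∀ w : WeilGroup F, f ∘ₗ r.ρ w = ((residueFieldCard F : C) ^ (deg w)) • (r.ρ w ∘ₗ f)) →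
        f ∘ₗ r.N = r.N ∘ₗ f → f = 0 :=
  Iff.rfl

/-- `r` is generic iff `Hom_WD(r, r(1)) = 0`.
Ref: Allen, Duke Math. J. 165 (2016), Def. 1.1.2. [cite: Allen2016, Def. 1.1.2] -/
theorem isGeneric_iff_twistedHom_eq_bot (r : WeilDeligneRep F C V) :
    r.IsGeneric ↔ r.twistedHom r = ⊥ := by
  rw [Submodule.eq_bot_iff]
  exact forall_congr' fun f =>
    ⟨fun h hf => h hf.1 hf.2, fun h hρ hN => h ((mem_twistedHom_iff r r f).mpr ⟨hρ, hN⟩)⟩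

/-- The eliminator: a morphism `f : r → r(1)` of a generic `r` vanishes.
Ref: Allen, Duke Math. J. 165 (2016), Def. 1.1.2. [cite: Allen2016, Def. 1.1.2] -/
theorem IsGeneric.eq_zero {r : WeilDeligneRep F C V} (h : r.IsGeneric) {f : V →ₗ[C] V}
    (hf : f ∈ r.twistedHom r) : f = 0 :=
  h f hf.1 hf.2

/-- **A retract of a generic representation is generic**: if `i : r' → r` and `p : r → r'` are
morphisms of Weil–Deligne representations with `p ∘ i = id` (e.g. `r'` a direct summand of
`r`), then `r` generic implies `r'` generic — a morphism `f : r' → r'(1)` gives the morphism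
`i ∘ f ∘ p : r → r(1)`, which vanishes, and `f = p ∘ (i ∘ f ∘ p) ∘ i`.
Ref: Allen, Duke Math. J. 165 (2016), §1.1 (used implicitly for `rec(π) = ⊕ rec(πᵢ) ⊗ Sp`).
[folklore] -/
theorem IsGeneric.of_retract {r : WeilDeligneRep F C V} {r' : WeilDeligneRep F C V'}
    (h : r.IsGeneric) (i : Hom r' r) (p : Hom r r')
    (hpi : p.toLinearMap ∘ₗ i.toLinearMap = LinearMap.id) : r'.IsGeneric := by
  intro f hρ hN
  have hf : f ∈ r'.twistedHom r' := ⟨hρ, hN⟩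
  have h0 : i.toLinearMap ∘ₗ f ∘ₗ p.toLinearMap = 0 := h.eq_zero (comp_mem_twistedHom hf p i)
  calc f = (p.toLinearMap ∘ₗ i.toLinearMap) ∘ₗ f ∘ₗ (p.toLinearMap ∘ₗ i.toLinearMap) := by
        rw [hpi, LinearMap.id_comp, LinearMap.comp_id]
    _ = p.toLinearMap ∘ₗ (i.toLinearMap ∘ₗ f ∘ₗ p.toLinearMap) ∘ₗ i.toLinearMap := by
        simp only [LinearMap.comp_assoc]
    _ = 0 := by rw [h0, LinearMap.zero_comp, LinearMap.comp_zero]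

/-- **Genericity is invariant under isomorphism** of Weil–Deligne representations.
Ref: Allen, Duke Math. J. 165 (2016), §1.1 (`WD(ρ)` is an isomorphism class). [folklore] -/
theorem IsGeneric.of_equiv {r : WeilDeligneRep F C V} {r' : WeilDeligneRep F C V'}
    (h : r.IsGeneric) (e : Equiv r r') : r'.IsGeneric :=
  h.of_retract e.symm.toHom e.toHom (by
    change (e.toLinearEquiv : V →ₗ[C] V') ∘ₗ (e.toLinearEquiv.symm : V' →ₗ[C] V) = LinearMap.id
    exact e.toLinearEquiv.comp_symm)

/-- Isomorphic Weil–Deligne representations are generic together.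
Ref: Allen, Duke Math. J. 165 (2016), §1.1. [folklore] -/
theorem Equiv.isGeneric_iff {r : WeilDeligneRep F C V} {r' : WeilDeligneRep F C V'}
    (e : Equiv r r') : r.IsGeneric ↔ r'.IsGeneric :=
  ⟨fun h => h.of_equiv e, fun h => h.of_equiv e.symm⟩

/-- `IsEquivalent` representations are generic together.
Ref: Allen, Duke Math. J. 165 (2016), §1.1. [folklore] -/
theorem IsEquivalent.isGeneric_iff {r : WeilDeligneRep F C V} {r' : WeilDeligneRep F C V'}
    (h : r.IsEquivalent r') : r.IsGeneric ↔ r'.IsGeneric := by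
  obtain ⟨e⟩ := h
  exact e.isGeneric_iff

/-- The zero representation is generic (vacuously: `V →ₗ V` is trivial).
Ref: Allen, Duke Math. J. 165 (2016), Def. 1.1.2. [folklore] -/
theorem isGeneric_of_subsingleton [Subsingleton V] (r : WeilDeligneRep F C V) : r.IsGeneric :=
  fun f _ _ => Subsingleton.elim f 0

/-- `q ^ d ≠ 1` in a field of characteristic zero for `d ≠ 0` (`q > 1` is the residue
cardinality; compare `residueFieldCard_zpow_ne_zero`).  Proof via `ℚ`, where `q ^ ·` is
injective.  Ref: Tate, Corvallis 1979, (1.4.1) (`‖w‖ = 1 ↔ w ∈ I_F`). [folklore] -/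
theorem residueFieldCard_zpow_ne_one {d : ℤ} (hd : d ≠ 0) : ((residueFieldCard F : C) ^ d) ≠ 1 := by
  have h1 : (1 : ℚ) < residueFieldCard F := by exact_mod_cast one_lt_residueFieldCard F
  intro h
  apply hd
  refine zpow_right_injective₀ (zero_lt_one.trans h1) h1.ne' ?_
  apply Rat.cast_injective (α := C)
  change ((((residueFieldCard F : ℚ)) ^ d : ℚ) : C) = ((((residueFieldCard F : ℚ)) ^ (0 : ℤ) : ℚ) : C)
  rw [Rat.cast_zpow, Rat.cast_zpow, Rat.cast_natCast, zpow_zero, h]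

/-- **Sanity value: the trivial representation `(1, 0)` is generic** (on any `V`), as soon as
`W_F` has an element `w₀` of non-zero degree (any Frobenius; cf. `WeilGroup.deg_surjective`):
a morphism `f : 1 → 1(1)` satisfies `f = q ^ deg w₀ • f`, and `q ^ deg w₀ ≠ 1`.  More generally
unramified characters are generic.
Ref: Allen, Duke Math. J. 165 (2016), §1.1 (proof of Lemma 1.1.3: `rec(π)` of a supercuspidal,
in particular a character, is generic). [folklore] -/
theorem isGeneric_trivial {w₀ : WeilGroup F} (hw₀ : deg w₀ ≠ 0) : (trivial (F := F) C V).IsGeneric := by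
  intro f hρ _
  have h := hρ w₀
  simp only [trivial, ofRep_ρ, Representation.trivial, MonoidHom.one_apply] at h
  change f ∘ₗ LinearMap.id = ((residueFieldCard F : C) ^ (deg w₀)) • (LinearMap.id ∘ₗ f) at h
  rw [LinearMap.comp_id, LinearMap.id_comp] at h
  have h' : (1 - (residueFieldCard F : C) ^ (deg w₀)) • f = 0 := by
    rw [sub_smul, one_smul, ← h, sub_self]
  exact (smul_eq_zero.mp h').resolve_left (sub_ne_zero.mpr (residueFieldCard_zpow_ne_one hw₀).symm)

/-- The threaded form of `isGeneric_trivial`: given the `LocalGaloisGroup` named facts making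
`deg` surjective (`IsFrobPow.mul`, `IsFrobPow.unique`, `exists_isFrobPow`, as in
`WeilGroup.deg_surjective`), the trivial representation is generic.
Ref: Allen, Duke Math. J. 165 (2016), §1.1. [folklore] -/
theorem isGeneric_trivial' (hmul : IsFrobPow.mul (F := F)) (huniq : IsFrobPow.unique (F := F))
    (hex : exists_isFrobPow (F := F)) : (trivial (F := F) C V).IsGeneric := by
  obtain ⟨w₀, hw₀⟩ := deg_surjective hmul huniq hex 1
  exact isGeneric_trivial (w₀ := w₀) (by rw [hw₀]; exact one_ne_zero)

end WeilDeligneRep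

end Literature.NumberTheory.GaloisRepresentations
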